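import Summits.BirchSwinnertonDyer.BirchSwinnertonDyer.Theorems.ErratumRoadFiveNonSurjCornerTwinMu
import Literature.NumberTheory.EllipticCurves.Rubin1998.ImprimitiveMultiplicativeDivisibility
import Literature.NumberTheory.EllipticCurves.Wuthrich2014.IntegralPAdicLFunctionMultiplicative
import Literature.NumberTheory.EllipticCurves.ComplexMultiplicationRationalJIntegralProofs
import Literature.NumberTheory.EllipticCurves.PAdicHeightsProofs

/-!
# Route `ErratumRoadFive` (rung K2a), crux 6 `NonSurjCorner` (item 19065): the twin's RATIONAL layer
# is PRINT — Rubin 1998 Thm. 8.7 (no image hypothesis, `N`-imprimitive) + Wuthrich 2014 Cor. 18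
# (`L_p(E) ∈ Λ`) — on the locus where the imprimitive Euler factors are `p`-adic units
# (cell `bsd-stepL`, seat `bsd-stepL-corner-p1` g4; `--supports stmt-BirchSwinnertonDyer-19065`)

Companion of `ErratumRoadFiveNonSurjCornerTwin{KatoEngine,Kato,Mu}.lean` (p453738 ∕ p454452 ∕
p456176). There the corner's rank-`0` twin input was reduced to x11c's typed divisibility
`X11b.MultDivisibilityAt Wd p`, itself = (Kato-12.5 (3)-shaped RATIONAL divisibility with
`ϖ·L_p ∈ Λ`) + (`μ(X(E^d/ℚ_∞)) = 0`), both hypothesis SHAPES. THIS FILE discharges the first layer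
BY CITATION on an explicit sub-locus:

* `Literature.NumberTheory.EllipticCurves.Rubin1998.thm87_charIdeal_dvd_imprimitive_multiplicative`
  (K. Rubin, *Euler systems and modular elliptic curves*, LMS LNS 254 (1998), Thm. 8.7): for a
  modular NON-CM curve with multiplicative reduction at `p` — NO hypothesis on `ρ̄_{E,p}`
  (`Hyp(ℚ_∞, V)` holds for every non-CM `E`, Prop. 8.3 (i)) — `X_∞` is `Λ`-torsion and
  `char(X_∞) ∣ p^t · 𝓛_{E,N}` (split: `𝒥 · char(X_∞)`), `𝓛_{E,N} = ∏_{q∣N, q≠p} ℓ_q(q⁻¹Fr_q⁻¹)·𝓛_E`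
  the `N`-IMPRIMITIVE function; the tree records the Euler product through its augmentation
  `∏ ℓ_q(q⁻¹) = (∏_{v∈S} 𝒫_v)(0)` only.
* `Literature.NumberTheory.EllipticCurves.Wuthrich2014.corollary18_padicLFunction_mem_iwasawaAlgebra_multiplicative`
  (Doc. Math. 19 (2014), Cor. 18): `ϖ · L ∈ ι(Λ)` at an odd multiplicative prime, every `E`.

Kernel content:
* §1 (`Λ`-algebra) `mem_charIdeal_of_imprimitive_of_isUnit`, `exists_mem_charIdeal_of_imprimitive_of_isUnit_split`:
  if `g ∈ char_Λ X` with `ι g = p^t·ϖ·L·ι(P)` (resp. `ι(T·g) = …`), `P(0) ∈ ℤ_p^×` (so `P ∈ Λ^×`,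
  `PowerSeries.isUnit_iff_constantCoeff`), `ϖ·L = ι G` and `μ(X) = 0`, then `G ∈ char_Λ X` (resp.
  `G = T·G'` with `G' ∈ char_Λ X`): injectivity of `ι`, the `μ = 0` cancellation of p456176
  (`mem_charIdeal_of_C_pow_mul_mem_of_mu_eq_zero`: `(p)` is prime in `ℤ_p⟦T⟧`), and absorption of
  the unit `P`; at a split prime `T ∣ G` because `0 = p^t · G(0) · P(0)` in the domain `ℤ_p`.
* §2 `multDivisibilityAt_of_imprimitive_of_integral_of_mu_eq_zero` — the Rubin-SHAPED imprimitive
  divisibility with a unit Euler constant + integrality + `μ = 0` ⟹ `X11b.MultDivisibilityAt W p`.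
* §3 **`multDivisibilityAt_of_thm87_of_corollary18_of_eulerUnit_of_mu_eq_zero`** — BY NAME: the two
  Literature facts + `p ≠ 2`, `p` multiplicative + a finite set `S ∌ (p)` of places containing the bad
  places `≠ p` with `(∏_{v∈S} 𝒫_v)(0) ∈ ℤ_p^×` (the EULER-UNIT CERTIFICATE: no multiplicative `q ≠ p`
  in `S` with `q ≡ a_q (mod p)`, no good `q ∈ S` with `p ∣ #Ẽ(𝔽_q)`; `𝒫_v(0) = P_v(E, q_v⁻¹)`) +
  `μ(X(E/ℚ_∞)) = 0` for every cyclotomic datum ⟹ `MultDivisibilityAt W p`. The CM hypothesis of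
  Thm. 8.7 is discharged by the tree (`not_hasCM_of_one_lt_norm_j`: a multiplicative prime makes `j`
  non-integral).
* §4 **`erratumRoadFive_nonSurjCorner_of_certificates_of_lowerX11a_of_thm87_of_twinEulerUnitOrMultDiv_of_twinMuZero`**:
  `pubs + Thm. 8.7 + Cor. 18 → EulerHalfOffLocus (19062) → X11aLowerHalf (19064) → Zₚᶜ → [x11c's typed
  divisibility ONLY at the leaf twins WITHOUT an Euler-unit certificate] → [μ = 0 at the leaf twins] →
  NonSurjCorner` — p454452's theorem with `hdiv` split by §3 along the Euler-unit locus.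

READING (for the planner ∕ rung K6). After this file the corner's twin summand is: `μ = 0` at the
non-surjective X11a leaf twins (K6's `KatoMuTransfer` object at `p ‖ N`) everywhere, plus x11c's
typed divisibility ONLY at twins having a multiplicative prime `q ≠ p` with `q ≡ a_q(E^d) (mod p)`
(there the located print is `N`-imprimitive and the Euler factor `𝒫_q` is not a unit of `Λ`; the
primitive statement is Kato's Thm. 12.5 (3) read through the Coleman map at `p ‖ N`, not located as a
printed theorem for these images). For the Heegner twin `E^{d_K}` of a corner curve `E` (all `q ∣ N`
split in `K`) `a_q(E^{d_K}) = a_q(E)`, so the certificate is read on `E`: of the three explicit `p = 7`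
corner pairs of CORNER-G4 §0 (iv), `t = 16/7` (multiplicative `13` split, `29` non-split: `12`, `30`
prime to `7`) HAS the certificate, `t = 17/7` (`337 ≡ 1`, split) and `t = -1/7` (`167 ≡ -1`,
non-split) do NOT; a multiplicative `q` inert in the Cartan field is `≡ -1 (mod p)` (its Frobenius
lies in `N(C) ∖ C`, eigenvalues `{a_q q, a_q} = {x, -x}`), so a NON-SPLIT multiplicative prime inert
in the Cartan field always violates it.

HONEST FRAMING. Theorems only (no `def`); the two inputs beyond p456176 are NAMED Literature facts
(hypotheses `h87`, `h18`, D-0014); every other non-print input of §4 is a hypothesis SHAPE as in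
p454452/p456176; nothing here proves `μ = 0` or the typed divisibility at any pair; item 19065 does
NOT close; no census word moves; BSD is not proved by any of this. Flag `Cha05-Rmk25-structure` rides
on §4; proposed flag `Rubin98-87-augmentation` (the fact records Rubin's Euler product through its
augmentation only).

References: [Rubin1998Durham] Thm. 4.1, Thm. 6.1, Prop. 8.3 (i), Thm. 8.7, Prop. A.2;
[Wuthrich2014] Cor. 18 (p. 398), Cor. 19 and p. 399; [Kato2004Asterisque] Thm. 12.5 (3) (p. 222);
[GreenbergVatsal2000] §1 pp. 8–9, Prop. (2.4); [Skinner2016PacificMC] §2.5; [Washington1997] §13.1;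
tree: `Theorems/ErratumRoadFiveNonSurjCornerTwin{KatoEngine,Kato,Mu}.lean`,
`X11b/MultiplicativeDivisibility.lean`, `GreenbergVatsal2000/NonPrimitivePAdicLFunction.lean`,
`X2/EulerFactorInvariants.lean`.
-/

noncomputable section

open scoped Classical NumberField MatrixGroups ModularForm

namespace Summit.BirchSwinnertonDyer.Rank1Residual.X11b

open CongruenceSubgroup WeierstrassCurve NumberField IsDedekindDomain Field
  Literature.NumberTheory.EllipticCurves
  Literature.NumberTheory.EllipticCurves.ModularForms
  Literature.NumberTheory.EllipticCurves.Rank1Residual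
  Literature.NumberTheory.EllipticCurves.Rank1Residual.Typed
  Literature.NumberTheory.EllipticCurves.Wuthrich2014
  Literature.NumberTheory.EllipticCurves.Rubin1998
  Literature.NumberTheory.EllipticCurves.SteinWuthrich2013
  Literature.NumberTheory.EllipticCurves.GreenbergVatsal2000
  Literature.NumberTheory.EllipticCurves.EmertonPollackWeston2006
  Literature.NumberTheory.QuadraticFields.Quadratic
  Summit.BirchSwinnertonDyer.Rank1Residual
  Summit.BirchSwinnertonDyer.Rank1Residual.X11b.Three.Koly

/-! ### §1 Λ-algebra: absorbing a unit Euler factor and a power of `p` into `char_Λ X` -/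

/-- `ι(C(p^t) · G · P) = C(p^t) · ι G · ι P` for the inclusion `ι : Λ ↪ ℚ_p⟦T⟧`. [folklore] -/
theorem iwasawaToPowerSeries_C_pow_mul_mul {p : ℕ} [Fact p.Prime] (t : ℕ) (G P : IwasawaAlgebra p) :
    iwasawaToPowerSeries p (PowerSeries.C ((p : ℤ_[p]) ^ t) * G * P) =
      PowerSeries.C ((p : ℚ_[p]) ^ t) * iwasawaToPowerSeries p G * iwasawaToPowerSeries p P := by
  rw [map_mul, map_mul, iwasawaToPowerSeries_C_natCast_pow]

/-- **Non-split shape.** If `g ∈ char_Λ X` with `ι g = p^t · c · L · ι P`, `P(0) ∈ ℤ_p^×`, `ι G = c · L`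
and `μ(X) = 0` (`X` torsion), then `G ∈ char_Λ X`: `g = p^t · (G · P)` by injectivity of `ι`, the power
of `p` cancels against `char_Λ X` because `(p) ⊂ ℤ_p⟦T⟧` is prime and `μ = 0`
(`mem_charIdeal_of_C_pow_mul_mem_of_mu_eq_zero`), and `P` is a unit of `Λ`
(`PowerSeries.isUnit_iff_constantCoeff`). [cite: Washington1997, §13.1]
[cite: GreenbergVatsal2000, p. 2, (1)–(2)] -/
theorem mem_charIdeal_of_imprimitive_of_isUnit {p : ℕ} [Fact p.Prime]
    {W : WeierstrassCurve ℚ} [W.IsElliptic] {κ : ZpExtension ℚ p} {γ : Field.absoluteGaloisGroup ℚ}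
    (hγ : κ.IsTopGenerator γ) (D : W.SelmerDualData κ γ) (hX : D.IsTorsion) (hμ : D.mu = 0)
    {t : ℕ} {P g G : IwasawaAlgebra p} {c : ℚ_[p]} {L : PowerSeries ℚ_[p]}
    (hP : IsUnit (PowerSeries.constantCoeff P)) (hg : g ∈ D.charIdeal)
    (hι : iwasawaToPowerSeries p g =
      PowerSeries.C ((p : ℚ_[p]) ^ t * c) * L * iwasawaToPowerSeries p P)
    (hG : iwasawaToPowerSeries p G = PowerSeries.C c * L) :
    G ∈ D.charIdeal := by
  have hgeq : g = PowerSeries.C ((p : ℤ_[p]) ^ t) * (G * P) := by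
    apply iwasawaToPowerSeries_injective p
    rw [← mul_assoc, iwasawaToPowerSeries_C_pow_mul_mul, hG, hι, map_mul]
    ring
  have hGP : G * P ∈ D.charIdeal :=
    mem_charIdeal_of_C_pow_mul_mem_of_mu_eq_zero hγ D hX hμ t (hgeq ▸ hg)
  obtain ⟨u, hu⟩ := PowerSeries.isUnit_iff_constantCoeff.mpr hP
  have : G = G * P * ↑u⁻¹ := by rw [← hu, mul_assoc, Units.mul_inv, mul_one]
  rw [this]
  exact Ideal.mul_mem_right _ _ hGP

/-- **Split shape.** If `g ∈ char_Λ X` with `ι(T · g) = p^t · c · L · ι P`, `P(0) ∈ ℤ_p^×`, `ι G = c · L`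
and `μ(X) = 0` (`X` torsion), then `G = T · G'` for some `G' ∈ char_Λ X` (so `ι(T · G') = c · L`):
`T · g = p^t · G · P` forces `G(0) = 0` in the domain `ℤ_p` (`p^t ≠ 0`, `P(0)` a unit), i.e. `T ∣ G`
(`PowerSeries.X_dvd_iff`); cancel `T` and conclude as in the non-split shape.
[cite: Washington1997, §13.1] [cite: GreenbergVatsal2000, p. 2, (1)–(2)] -/
theorem exists_mem_charIdeal_of_imprimitive_of_isUnit_split {p : ℕ} [Fact p.Prime]
    {W : WeierstrassCurve ℚ} [W.IsElliptic] {κ : ZpExtension ℚ p} {γ : Field.absoluteGaloisGroup ℚ}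
    (hγ : κ.IsTopGenerator γ) (D : W.SelmerDualData κ γ) (hX : D.IsTorsion) (hμ : D.mu = 0)
    {t : ℕ} {P g G : IwasawaAlgebra p} {c : ℚ_[p]} {L : PowerSeries ℚ_[p]}
    (hP : IsUnit (PowerSeries.constantCoeff P)) (hg : g ∈ D.charIdeal)
    (hι : iwasawaToPowerSeries p (PowerSeries.X * g) =
      PowerSeries.C ((p : ℚ_[p]) ^ t * c) * L * iwasawaToPowerSeries p P)
    (hG : iwasawaToPowerSeries p G = PowerSeries.C c * L) :
    ∃ G' ∈ D.charIdeal, iwasawaToPowerSeries p (PowerSeries.X * G') = PowerSeries.C c * L := by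
  have hgeq : PowerSeries.X * g = PowerSeries.C ((p : ℤ_[p]) ^ t) * (G * P) := by
    apply iwasawaToPowerSeries_injective p
    rw [← mul_assoc, iwasawaToPowerSeries_C_pow_mul_mul, hG, hι, map_mul]
    ring
  -- constant coefficients: `0 = p^t · G(0) · P(0)`, so `G(0) = 0`
  have h0 : PowerSeries.constantCoeff G = 0 := by
    have h := congrArg PowerSeries.constantCoeff hgeq
    simp only [map_mul, PowerSeries.constantCoeff_X, zero_mul, PowerSeries.constantCoeff_C] at h
    obtain ⟨u, hu⟩ := hP
    have hpt : ((p : ℤ_[p]) ^ t) ≠ 0 :=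
      pow_ne_zero _ (Nat.cast_ne_zero.mpr (Fact.out : p.Prime).ne_zero)
    rcases mul_eq_zero.mp h.symm with h1 | h2
    · exact absurd h1 hpt
    · rcases mul_eq_zero.mp h2 with h3 | h4
      · exact h3
      · exact absurd h4 (hu ▸ u.ne_zero)
  obtain ⟨G', hG'⟩ := PowerSeries.X_dvd_iff.mpr h0
  refine ⟨G', ?_, by rw [← hG', hG]⟩
  have hgeq' : g = PowerSeries.C ((p : ℤ_[p]) ^ t) * (G' * P) := by
    apply mul_left_cancel₀ (PowerSeries.X_ne_zero (R := ℤ_[p]))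
    rw [hgeq, hG']
    ring
  have hGP : G' * P ∈ D.charIdeal :=
    mem_charIdeal_of_C_pow_mul_mem_of_mu_eq_zero hγ D hX hμ t (hgeq' ▸ hg)
  obtain ⟨u, hu⟩ := PowerSeries.isUnit_iff_constantCoeff.mpr hP
  have : G' = G' * P * ↑u⁻¹ := by rw [← hu, mul_assoc, Units.mul_inv, mul_one]
  rw [this]
  exact Ideal.mul_mem_right _ _ hGP

/-! ### §2 x11c's typed divisibility from an imprimitive divisibility with UNIT Euler constant -/

/-- **`MultDivisibilityAt W p` from (Rubin-8.7-SHAPED imprimitive divisibility whose Euler constant is a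
`p`-adic unit) + (`ϖ · L ∈ ι(Λ)`, Wuthrich-Cor.-18-shaped) + (`μ(X(E/ℚ_∞)) = 0` for every cyclotomic dual
datum).** All three inputs are hypothesis SHAPES here; §3 supplies the first two BY NAME.
[cite: Rubin1998Durham, Thm. 8.7 (shape)] [cite: Wuthrich2014, Cor. 18 (p. 398) (shape)]
[cite: GreenbergLNM1716, §1 Conj. 1.11 (shape of μ = 0)] -/
theorem multDivisibilityAt_of_imprimitive_of_integral_of_mu_eq_zero (W : WeierstrassCurve ℚ)
    [W.IsElliptic] [W.IsGloballyMinimal] (p : ℕ) [Fact p.Prime]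
    (himp : ∀ {κ : ZpExtension ℚ p} {γ : Field.absoluteGaloisGroup ℚ} {N : ℕ} [NeZero N]
      {f : CuspForm (Gamma0 N) 2},
      κ.IsCyclotomic → κ.IsTopGenerator γ → IsCyclotomicVariable p γ → IsNewformOf W f →
      ∀ (D : W.SelmerDualData κ γ) (ϖ : ℚ), (ϖ : ℝ) * W.realPeriodRat = plusPeriod f →
        D.IsTorsion ∧
        ∃ (t : ℕ) (P : IwasawaAlgebra p), IsUnit (PowerSeries.constantCoeff P) ∧
          (¬ W.HasSplitMultiplicativeReductionAtPrime p →
            ∀ L : PowerSeries ℚ_[p], IsMultPAdicLFunctionOf f p (-1) L →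
              ∃ g ∈ D.charIdeal, iwasawaToPowerSeries p g =
                PowerSeries.C ((p : ℚ_[p]) ^ t * ((ϖ : ℚ) : ℚ_[p])) * L * iwasawaToPowerSeries p P) ∧
          (W.HasSplitMultiplicativeReductionAtPrime p →
            ∀ L : PowerSeries ℚ_[p], IsSplitMultPAdicLFunctionOf f p L →
              ∃ g ∈ D.charIdeal, iwasawaToPowerSeries p (PowerSeries.X * g) =
                PowerSeries.C ((p : ℚ_[p]) ^ t * ((ϖ : ℚ) : ℚ_[p])) * L * iwasawaToPowerSeries p P))
    (hint : ∀ {N : ℕ} [NeZero N] {f : CuspForm (Gamma0 N) 2}, IsNewformOf W f →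
      ∀ (ϖ : ℚ), (ϖ : ℝ) * W.realPeriodRat = plusPeriod f →
        (¬ W.HasSplitMultiplicativeReductionAtPrime p →
          ∀ L : PowerSeries ℚ_[p], IsMultPAdicLFunctionOf f p (-1) L →
            ∃ G : IwasawaAlgebra p, iwasawaToPowerSeries p G = PowerSeries.C ((ϖ : ℚ) : ℚ_[p]) * L) ∧
        (W.HasSplitMultiplicativeReductionAtPrime p →
          ∀ L : PowerSeries ℚ_[p], IsSplitMultPAdicLFunctionOf f p L →
            ∃ G : IwasawaAlgebra p, iwasawaToPowerSeries p G = PowerSeries.C ((ϖ : ℚ) : ℚ_[p]) * L))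
    (hμ : ∀ (κ : ZpExtension ℚ p) (γ : Field.absoluteGaloisGroup ℚ),
      κ.IsCyclotomic → κ.IsTopGenerator γ → IsCyclotomicVariable p γ →
      ∀ D : W.SelmerDualData κ γ, D.mu = 0) :
    MultDivisibilityAt W p := by
  intro κ γ N _ f hκ hγ hγ' hf D ϖ _hϖ0 hϖ
  obtain ⟨hX, t, P, hPu, hns, hs⟩ := himp hκ hγ hγ' hf D ϖ hϖ
  have hμD : D.mu = 0 := hμ κ γ hκ hγ hγ' D
  refine ⟨hX, fun hn L hL => ?_, fun hsp L hL => ?_⟩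
  · obtain ⟨g, hg, hι⟩ := hns hn L hL
    obtain ⟨G, hG⟩ := (hint hf ϖ hϖ).1 hn L hL
    exact ⟨G, mem_charIdeal_of_imprimitive_of_isUnit hγ D hX hμD hPu hg hι hG, hG⟩
  · obtain ⟨g, hg, hι⟩ := hs hsp L hL
    obtain ⟨G, hG⟩ := (hint hf ϖ hϖ).2 hsp L hL
    exact exists_mem_charIdeal_of_imprimitive_of_isUnit_split hγ D hX hμD hPu hg hι hG

/-! ### §3 By NAME: Rubin 1998 Thm. 8.7 + Wuthrich 2014 Cor. 18 + Euler-unit certificate + `μ = 0` -/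

/-- **x11c's typed divisibility at a pair `(W, p)`, `p ≠ 2` multiplicative, from the two Literature facts
on the EULER-UNIT locus, modulo `μ = 0`.** Inputs: Rubin 1998 Thm. 8.7 (`h87`, named fact: `X_∞`
torsion and `p^t·ϖ·L·ι P ∈ ι(char_Λ X)` resp. `∈ ι(T·char_Λ X)` with `P(0) = (∏_{v∈S} 𝒫_v)(0)`, no
image hypothesis; its CM hypothesis is discharged by the tree, `not_hasCM_of_one_lt_norm_j` +
`one_lt_norm_j_of_hasMultiplicativeReductionAtPrime`); Wuthrich 2014 Cor. 18 (`h18`, named fact: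
`ϖ·L ∈ ι(Λ)`); a finite set `S` of places `v ∤ p` containing the bad places `≠ p` (`hS`, `hSp`) whose
Euler product has UNIT augmentation (`hEU` — the Euler-unit certificate of the pair: no multiplicative
`q ≠ p` in `S` with `q ≡ a_q (mod p)`, since `𝒫_v(0) = P_v(E, q_v⁻¹) = 1 - a_{q_v} q_v⁻¹` there);
`μ(X(E/ℚ_∞)) = 0` for every cyclotomic dual datum (`hμ`, hypothesis SHAPE — rung K6's object).
CONDITIONAL on the two named facts and `hμ`; nothing asserted about any particular curve.
[cite: Rubin1998Durham, Thm. 8.7 with Thm. 6.1 and Prop. 8.3 (i)] [cite: Wuthrich2014, Cor. 18 (p. 398)]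
[cite: GreenbergVatsal2000, §1 pp. 8–9 (𝒫_ℓ(0) = P_ℓ(ℓ⁻¹))] [cite: SilvermanAEC2009, Prop. VII.5.1(b)]
[cite: GreenbergLNM1716, §1 Conj. 1.11 (shape of μ = 0)] -/
theorem multDivisibilityAt_of_thm87_of_corollary18_of_eulerUnit_of_mu_eq_zero
    (h87 : Rubin1998.thm87_charIdeal_dvd_imprimitive_multiplicative)
    (h18 : Wuthrich2014.corollary18_padicLFunction_mem_iwasawaAlgebra_multiplicative)
    (W : WeierstrassCurve ℚ) [W.IsElliptic] [W.IsGloballyMinimal] (p : ℕ) [Fact p.Prime]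
    (hp : p ≠ 2) (hmult : W.HasMultiplicativeReductionAtPrime p)
    (S : Finset (HeightOneSpectrum (𝓞 ℚ)))
    (hS : ∀ v : HeightOneSpectrum (𝓞 ℚ), ¬ W.HasGoodReductionAt v →
      Rat.HeightOneSpectrum.natGenerator v ≠ p → v ∈ S)
    (hSp : ∀ v ∈ S, Rat.HeightOneSpectrum.natGenerator v ≠ p)
    (hEU : IsUnit (PowerSeries.constantCoeff (eulerFactorProduct W p S)))
    (hμ : ∀ (κ : ZpExtension ℚ p) (γ : Field.absoluteGaloisGroup ℚ),
      κ.IsCyclotomic → κ.IsTopGenerator γ → IsCyclotomicVariable p γ →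
      ∀ D : W.SelmerDualData κ γ, D.mu = 0) :
    MultDivisibilityAt W p := by
  refine multDivisibilityAt_of_imprimitive_of_integral_of_mu_eq_zero W p ?_ ?_ hμ
  · intro κ γ N _ f hκ hγ hγ' hf D ϖ hϖ
    -- the CM hypothesis of Thm. 8.7 is discharged by the tree: a multiplicative prime makes `j` non-integral
    obtain ⟨hX, t, P, hP0, hns, hs⟩ := h87 W p S hp hmult
      (W.not_hasCM_of_one_lt_norm_j (one_lt_norm_j_of_hasMultiplicativeReductionAtPrime hmult))
      hS hSp hκ hγ hγ' hf D ϖ hϖ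
    exact ⟨hX, t, P, hP0 ▸ hEU, hns, hs⟩
  · intro N _ f hf ϖ hϖ
    exact h18 W p hp hmult hf ϖ hϖ

/-! ### §4 The corner: the typed divisibility is needed only OFF the Euler-unit locus of the leaf twins -/

/-- **`NonSurjCorner` modulo print + Rubin 1998 Thm. 8.7 + Wuthrich 2014 Cor. 18 + EulerHalfOffLocus (19062)
+ X11aLowerHalf (19064) + Zₚᶜ + [x11c's typed divisibility at the leaf twins WITHOUT an Euler-unit
certificate] + [`μ = 0` at the leaf twins]** — p454452's
`erratumRoadFive_nonSurjCorner_of_certificates_of_lowerX11a_of_twinMultDivisibility` with its binder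
`hdiv` (x11c's `MultDivisibilityAt` on the non-surjective X11a leaf at `p ∈ {5,7}`) SPLIT along the
Euler-unit locus: at a leaf twin `Wd` admitting a finite set `S` of places as in §3 with unit Euler
augmentation, `MultDivisibilityAt Wd p` is §3 (two named facts + `hμ`); only at the other twins
(`hoff`: some multiplicative `q ≠ p` with `q ≡ a_q (mod p)` in every admissible `S`) is the typed
divisibility still an input. PUBLISHED binders as in p454452 plus `h87`, `h18`. CONDITIONAL on `h₂`,
`h₄`, `hZ`, `hoff`, `hμ`; does NOT close item 19065; nothing booked.
[cite: Rubin1998Durham, Thm. 8.7] [cite: Wuthrich2014, Cor. 18 (p. 398)]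
[cite: Cha2005, Rmk. 25 (p. 175)] [cite: MatarNekovar2019, Thm. 0.3, §0.9, §0.11 (pp. 456–457)]
[cite: WZhang2014, Thm. 1.1 and Rem. 5 (shape of Zₚᶜ)] [cite: SteinWuthrich2013, Thm. 6.1 (p. 20)]
[cite: JetchevSkinnerWan2017, §7.4.1–7.4.2 (pp. 30–31)] [cite: GreenbergLNM1716, §1 Conj. 1.11 (shape of μ = 0)] -/
theorem erratumRoadFive_nonSurjCorner_of_certificates_of_lowerX11a_of_thm87_of_twinEulerUnitOrMultDiv_of_twinMuZero
    (hGZ : ∀ (N : ℕ) [NeZero N] (W : WeierstrassCurve ℚ) (K : Type) [Field K] [NumberField K],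
      gross_zagier N W K)
    (hKo : ∀ (N : ℕ) [NeZero N] (W : WeierstrassCurve ℚ) (K : Type) [Field K] [NumberField K],
      kolyvagin N W K)
    (hWu : sha_dvd_analyticSha)
    (hMN : ∀ (N : ℕ) [NeZero N] (W : WeierstrassCurve ℚ) (K : Type) [Field K] [NumberField K],
      MatarNekovar2019.thm03_padicValNat_card_sha_le_of_irreducible N W K)
    (hGZK : rank_eq_analyticRank_of_analyticRank_le_one) (hmod : hasEntireLFunction_rat)
    (hnf : exists_isNewformOf) (hpar : nonempty_modularParametrizationData)
    (hFHs : friedbergHoffstein_exists_heegnerField_split_twist_ne_zero)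
    (hMaz : mazur_not_dvd_maninConstant_of_odd)
    (hrec : ∀ (N : ℕ) [NeZero N] (W : WeierstrassCurve ℚ) (K : Type) [Field K] [NumberField K],
      heegnerPointOfConductor_one_galoisConj N W K)
    (hD36 : ∀ (N : ℕ) [NeZero N] (W : WeierstrassCurve ℚ) (K : Type) [Field K] [NumberField K],
      phi_heegnerTau_mem_singularModuliField N W K)
    (hJs : thm61_splitMultiplicative) (hJn : thm61_nonsplitMultiplicative)
    (hGS : ∀ (W : WeierstrassCurve ℚ) [W.IsElliptic] [W.IsGloballyMinimal] (p : ℕ) [Fact p.Prime],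
      greenberg_stevens (W := W) (p := p))
    (hChaL : Cha2005.rmk25_pow_dvd_card_sha_primary_of_certificate)
    -- the two new named facts
    (h87 : Rubin1998.thm87_charIdeal_dvd_imprimitive_multiplicative)
    (h18 : Wuthrich2014.corollary18_padicLFunction_mem_iwasawaAlgebra_multiplicative)
    (h₂ : Summit.BirchSwinnertonDyer.BirchSwinnertonDyer.Theses.ErratumRoadFive.EulerHalfOffLocus)
    (h₄ : Summit.BirchSwinnertonDyer.BirchSwinnertonDyer.Theses.ErratumRoadFive.X11aLowerHalf)
    -- Zₚᶜ: certificates on corner frames (`M_∞ ≤ t`)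
    (hZ : ∀ (W : WeierstrassCurve ℚ) [W.IsElliptic] [W.IsGloballyMinimal] (p : ℕ) [Fact p.Prime]
      (N : ℕ) [NeZero N] (K : Type) [Field K] [NumberField K]
      (Dt : ModularParametrizationData W N) (β : ℤ) (ι : K →+* ℂ),
      ClassX11b W p → ¬ Surj W p → (p = 5 ∨ p = 7) → p ∣ padicValInt p W.minimalDiscriminantInt →
      ¬ Ram W p → W.conductorNorm ℤ = N → IsImaginaryQuadratic K →
      4 < (NumberField.discr K).natAbs → SatisfiesHeegnerHypothesis N K →
      SatisfiesHeegnerHypothesis p K → (4 * (N : ℤ)) ∣ β ^ 2 - NumberField.discr K → ¬ (p : ℤ) ∣ Dt.c →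
      ∃ M : ℕ, M ≤ padicValNat p W.tamagawaProduct ∧ CertificateAt Dt β ι p M)
    -- x11c's typed divisibility ONLY at the leaf twins WITHOUT an Euler-unit certificate
    (hoff : ∀ (Wd : WeierstrassCurve ℚ) [Wd.IsElliptic] [Wd.IsGloballyMinimal] (p : ℕ) [Fact p.Prime],
      ClassX11a Wd p → ¬ Surj Wd p → (p = 5 ∨ p = 7) → p ∣ padicValInt p Wd.minimalDiscriminantInt →
      (¬ ∃ S : Finset (HeightOneSpectrum (𝓞 ℚ)),
        (∀ v : HeightOneSpectrum (𝓞 ℚ), ¬ Wd.HasGoodReductionAt v →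
          Rat.HeightOneSpectrum.natGenerator v ≠ p → v ∈ S) ∧
        (∀ v ∈ S, Rat.HeightOneSpectrum.natGenerator v ≠ p) ∧
        IsUnit (PowerSeries.constantCoeff (eulerFactorProduct Wd p S))) →
      MultDivisibilityAt Wd p)
    -- Greenberg's μ = 0 at the leaf twins (rung K6's object; hypothesis shape)
    (hμ : ∀ (Wd : WeierstrassCurve ℚ) [Wd.IsElliptic] [Wd.IsGloballyMinimal] (p : ℕ) [Fact p.Prime],
      ClassX11a Wd p → ¬ Surj Wd p → (p = 5 ∨ p = 7) → p ∣ padicValInt p Wd.minimalDiscriminantInt →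
      ∀ (κ : ZpExtension ℚ p) (γ : Field.absoluteGaloisGroup ℚ),
        κ.IsCyclotomic → κ.IsTopGenerator γ → IsCyclotomicVariable p γ →
        ∀ D : Wd.SelmerDualData κ γ, D.mu = 0) :
    Summit.BirchSwinnertonDyer.BirchSwinnertonDyer.Theses.ErratumRoadFive.NonSurjCorner :=
  erratumRoadFive_nonSurjCorner_of_certificates_of_lowerX11a_of_twinMultDivisibility hGZ hKo hWu hMN hGZK
    hmod hnf hpar hFHs hMaz hrec hD36 hJs hJn hGS hChaL h₂ h₄ hZ
    (fun Wd _ _ p _ hXa hnsd h57 hvd ↦ by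
      by_cases hS : ∃ S : Finset (HeightOneSpectrum (𝓞 ℚ)),
          (∀ v : HeightOneSpectrum (𝓞 ℚ), ¬ Wd.HasGoodReductionAt v →
            Rat.HeightOneSpectrum.natGenerator v ≠ p → v ∈ S) ∧
          (∀ v ∈ S, Rat.HeightOneSpectrum.natGenerator v ≠ p) ∧
          IsUnit (PowerSeries.constantCoeff (eulerFactorProduct Wd p S))
      · obtain ⟨S, hS1, hS2, hEU⟩ := hS
        exact multDivisibilityAt_of_thm87_of_corollary18_of_eulerUnit_of_mu_eq_zero h87 h18 Wd p
          hXa.2.1 hXa.2.2.1 S hS1 hS2 hEU (hμ Wd p hXa hnsd h57 hvd)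
      · exact hoff Wd p hXa hnsd h57 hvd hS)

end Summit.BirchSwinnertonDyer.Rank1Residual.X11b

end
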